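import Summits.CriticalPhenomena.PercolationContinuityZ3.Theorems.Transplant.KNCells2ThetaPosChosen
import HarnessLib

/-!
# F8 (generic, lag-1 anchors), design (D): the bundled probabilistic obligations of the node AT CHOSEN EDGES (`KitAtChosen`, the
# chosen-edge form of stmt's `KSchA.KitAt`) and `theta_pos_of_kitAtChosen`

builds on p205010 (kernel theorem, internal audit signed; external expert review pending) — nothing in this file uses p205010.
Lane `prim-bschramm`, seat `prim-bschramm-p5` (gen 3, refuter; interface objection 14:41Z, lead GO 14:42Z), helper file
(`--supports stmt-CriticalPhenomena-4575`).  See `KNCells2ThetaPosChosen` for the diagnosis; this file only bundles the three clauses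
(root kit; target lemma at the faces and corridor bound, both asked after valid histories AT THE EDGE THE SCHEME CHOOSES) into one
`Prop`, exactly as `BoxProdZ2DropAssembly`'s `KitAt` does for the all-edges form, so that the (D) partial closure can target it.
[cite: KozmaNitzan2024, §4 Theorem 6 (pp. 25–31), (30), (32)]
-/

noncomputable section

open MeasureTheory ProbabilityTheory
open scoped ENNReal Classical

namespace Summit.CriticalPhenomena.PercolationContinuityZ3.Theorems

namespace Transplant

namespace KNCells

open Literature.Probability.Percolation Literature.Probability.LatticeModels SimpleGraph GadgetSystem ProbeHistory HSiteScheme Contour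

namespace KSchA

variable {V : Type} [DecidableEq V] [Countable V]
variable {A : Type*} {G : SimpleGraph V} [G.LocallyFinite] {S : KSchA V A} {FD : FaceData V A} {LD : LevelData V A}

/-- **The probabilistic obligations of the node AT CHOSEN EDGES** (stmt's `KitAt` with `(S.astOf₂ G h).st.choice = some e` added to the
face and corridor clauses; the root clause is unchanged). [cite: KozmaNitzan2024, §4 (30), (32), Lemma 10 at the faces, Lemmas 11–12] -/
def KitAtChosen (G : SimpleGraph V) [G.LocallyFinite] (S : KSchA V A) (FD : FaceData V A) (δ₂ ε' : ℝ) : Prop :=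
  (∀ du : MDir, 1 - S.δc < (prodBernoulli (pinW (KNLevels.lattW G S.p) ↑(S.U₀ G) ↑(S.U₀ G))).real
      (⋃ t ∈ (↑(S.Γ.M S.Γ.a₀ ((0 : Site 2) + stepVec du)) : Set V),
        openConnIn (↑(S.Γ.Q S.Γ.a₀ 0 ∪ S.Γ.Ewv S.Γ.a₀ 0 du) : Set V) S.Γ.root t)) ∧
  (∀ h e, (S.astOf₂ G h).st.choice = some e → S.Valid₂ G h e → ∀ du ∈ S.onward G h (tgt e), ∀ j < S.Γ.K,
      ∀ o : Finset (Sym2 V),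
      1 - δ₂ < (prodBernoulli (S.Wt G h e (S.aOf₁ G h e) (S.aOf₂ G h e) du j o)).real
        (⋃ b ∈ FD.Face (S.aOf₂ G h e) (tgt e) du (j + 1), openConn S.Γ.root b) →
        S.cond G h e (S.aOf₁ G h e) (S.aOf₂ G h e) du j o) ∧
  (∀ h e, (S.astOf₂ G h).st.choice = some e → S.Valid₂ G h e → ∀ du ∈ S.onward G h (tgt e),
      1 - ε' < (prodBernoulli (S.Wfull G h e (S.aOf₁ G h e) (S.aOf₂ G h e) du)).real
        (S.Reach G FD h e (S.aOf₁ G h e) (S.aOf₂ G h e) du))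

/-- **Records + constants + `KitAtChosen` ⟹ `θ_{root}(p) > 0`.** [cite: KozmaNitzan2024, §4 Theorem 6 (pp. 25–31)] -/
theorem theta_pos_of_kitAtChosen (hΓ : RunGeom G S.Γ) (hA : AnchGeom S.Γ) (hsep : SepGeom₂ G S.Γ) (hX : ExitGeom G S.Γ)
    (hSt : StepsGeom S.Γ FD) (hL : LevelGeom G S.Γ FD LD) (hδc : S.δc ≤ 1) {ε ε' δ₂ : ℝ} (hε : ε ≤ (1 / 2) ^ 32) (hε' : 0 ≤ ε')
    (hδ₂ : δ₂ ≤ 1) (hKε : 4 * ((1 - δ₂) ^ S.Γ.K + ε') ≤ ε) (hp : 0 < (S.p : ℝ)) (hkit : KitAtChosen G S FD δ₂ ε') :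
    0 < theta G S.Γ.root S.p := by
  obtain ⟨hQ0, hface, hreach⟩ := hkit
  exact theta_pos_of_kit₂_chosen' hΓ hA hsep hX hSt hL hδc hε hε' hδ₂ hKε hp hQ0 hface hreach

omit [Countable V] in
/-- The all-edges form implies the chosen-edges form (so every landed discharge of the stronger interface still serves). [folklore] -/
theorem kitAtChosen_of_forall {δ₂ ε' : ℝ}
    (hQ0 : ∀ du : MDir, 1 - S.δc < (prodBernoulli (pinW (KNLevels.lattW G S.p) ↑(S.U₀ G) ↑(S.U₀ G))).real
      (⋃ t ∈ (↑(S.Γ.M S.Γ.a₀ ((0 : Site 2) + stepVec du)) : Set V),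
        openConnIn (↑(S.Γ.Q S.Γ.a₀ 0 ∪ S.Γ.Ewv S.Γ.a₀ 0 du) : Set V) S.Γ.root t))
    (hface : ∀ h e, S.Valid₂ G h e → ∀ du ∈ S.onward G h (tgt e), ∀ j < S.Γ.K, ∀ o : Finset (Sym2 V),
      1 - δ₂ < (prodBernoulli (S.Wt G h e (S.aOf₁ G h e) (S.aOf₂ G h e) du j o)).real
        (⋃ b ∈ FD.Face (S.aOf₂ G h e) (tgt e) du (j + 1), openConn S.Γ.root b) →
        S.cond G h e (S.aOf₁ G h e) (S.aOf₂ G h e) du j o)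
    (hreach : ∀ h e, S.Valid₂ G h e → ∀ du ∈ S.onward G h (tgt e),
      1 - ε' < (prodBernoulli (S.Wfull G h e (S.aOf₁ G h e) (S.aOf₂ G h e) du)).real
        (S.Reach G FD h e (S.aOf₁ G h e) (S.aOf₂ G h e) du)) :
    KitAtChosen G S FD δ₂ ε' :=
  ⟨hQ0, fun h e _ hV => hface h e hV, fun h e _ hV => hreach h e hV⟩


end KSchA

end KNCells

end Transplant

end Summit.CriticalPhenomena.PercolationContinuityZ3.Theorems

end
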